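import Mathlib
import Summits.Ventures.PercRepro2.Defs
import Summits.Ventures.PercRepro2.Independence
import Summits.Ventures.PercRepro2.Harris
import Summits.Ventures.PercRepro2.Graph
import Summits.Ventures.PercRepro2.Exploration
import Summits.Ventures.PercRepro2.Events
import Summits.Ventures.PercRepro2.Statements
import Summits.Ventures.PercRepro2.Induced

/-!
# Typed statements, part 2: the rows of `CONJECTURES.md` v2.11 (blind cell PercRepro2, typer-1)

* `R4Plus` — **R4+** (the `(3)`-strength good quadruple): `Γ(G, A, v, b) ≤ P(v ↔ A, v ↔ b)`,
  `Γ = min_a P(a ↔ b) − GQ(b)` (`explorationFunctional`); `IsGood` (R4) is the weaker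
  `Γ ≤ P(v ↔ b)`;
* `R4fPlus` — **R4f+**, the monotone-`f` analogue:
  `E[f(v); v ↔ A] ≥ min_a E f(a) − Σ_{W ∩ A = ∅} P(C(v) = W) · min_a E_{G∖W} f(a)`
  (`E_{G∖W} f(a)` = p1's `delExpect`, `Induced.lean`);
* `R2Prime` — **R2′**: `(3)` at the `b`-distance minimiser `a* = argmin_a P(a ↔ b)`;
  `R2PrimeF` — **R2′f**: Conjecture 4 at the `f`-minimiser;
* `R14` — **M1-H7**: positive association of `C(s)` given the pairwise separation
  `D = {s ↮ t, s ↮ u, t ↮ u}`;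
* `Separates` — `S` separates `x` from `y` (every `x–y` path meets `S`);
  `R11` — **SEP-MONO**: `q ↦ P_q(s ↔ t | s ↔ S)` is non-decreasing on `(0, 1)` for uniform
  weights when `S` separates `s` from `t`;
  `R12` — the **vdB–Kahn equality locus**: the conditional covariance of `{s ↔ a}`, `{s ↔ b}`
  given `s ↮ t` vanishes for all uniform `q ∈ (0, 1)` iff `{s, t}` separates `a` from `b`, or
  `t` separates `s` from `a` or from `b`.
-/

namespace Summit.Ventures.PercRepro2

section Objects

variable {V : Type*} {E : Type*} [Fintype V] [DecidableEq V] [Fintype E] [DecidableEq E]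
  {R : Type*} [CommRing R]

/-- `S` separates `x` from `y`: `x ↮ y` once every edge touching `S` is closed (all other edges
open). -/
def Separates (ends : E → Sym2 V) (S : Finset V) (x y : V) : Prop :=
  ¬ Conn ends (restrict (touches ends ↑S)ᶜ fun _ => true) x y

end Objects

section Rows

variable {V : Type*} {E : Type*} [Fintype V] [DecidableEq V] [Fintype E] [DecidableEq E]
  {R : Type*} [Field R] [LinearOrder R] [IsStrictOrderedRing R]

/-- **R4+** (`(3)`-strength GOOD-ALL): `Γ(G, A, v, b) ≤ P(v ↔ A, v ↔ b)`, i.e.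
`P(v ↔ A, v ↔ b) ≥ min_a P(a ↔ b) − Σ_{W ∩ A = ∅} P(C(v) = W) · min_a P_{G∖W}(a ↔ b)`. -/
def R4Plus (p : E → R) (ends : E → Sym2 V) (A : Finset V) (hA : A.Nonempty) (v b : V) : Prop :=
  explorationFunctional p ends A hA v b ≤ prob p (hitEvent ends v A ∩ connEvent ends v b)

/-- **R4f+** (monotone-`f` good quadruple):
`E[f(v); v ↔ A] ≥ min_a E f(a) − Σ_{W ∩ A = ∅} P(C(v) = W) · min_a E_{G∖W} f(a)`. -/
def R4fPlus (p : E → R) (ends : E → Sym2 V) (A : Finset V) (hA : A.Nonempty) (v : V)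
    (f : V → Config E → R) : Prop :=
  A.inf' hA (fun a => expect p (f a)) -
      ∑ W ∈ (Finset.univ : Finset (Finset V)).filter (fun W => Disjoint W A),
        prob p (clusterEvent ends v ↑W) * A.inf' hA (fun a => delExpect p ends f a ↑W) ≤
    hitExpect p ends A v f v

/-- **R2′** (`(3)` at the `b`-distance minimiser): for every `a* ∈ A` minimising `P(a ↔ b)`,
`P(v ↔ A, a* ↔ b) ≤ P(v ↔ b, v ↔ A)`. -/
def R2Prime (p : E → R) (ends : E → Sym2 V) (A : Finset V) (v b : V) : Prop :=
  ∀ a ∈ A, (∀ a' ∈ A, prob p (connEvent ends a b) ≤ prob p (connEvent ends a' b)) →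
    prob p (hitEvent ends v A ∩ connEvent ends a b) ≤
      prob p (connEvent ends v b ∩ hitEvent ends v A)

/-- **R2′f** (Conjecture 4 at the `f`-minimiser): for every `a* ∈ A` minimising `E f(a)`,
`E[f(a*); v ↔ A] ≤ E[f(v); v ↔ A]`. -/
def R2PrimeF (p : E → R) (ends : E → Sym2 V) (A : Finset V) (v : V) (f : V → Config E → R) :
    Prop :=
  ∀ a ∈ A, (∀ a' ∈ A, expect p (f a) ≤ expect p (f a')) →
    hitExpect p ends A v f a ≤ hitExpect p ends A v f v

/-- The pairwise separation event `D = {s ↮ t, s ↮ u, t ↮ u}`. -/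
def pairSep (ends : E → Sym2 V) (s t u : V) : Set (Config E) :=
  (connEvent ends s t)ᶜ ∩ (connEvent ends s u)ᶜ ∩ (connEvent ends t u)ᶜ

/-- **R14 / M1-H7**: positive association of the cluster of `s` given the pairwise separation
`D = {s ↮ t, s ↮ u, t ↮ u}`: `P(s ↔ a, s ↔ b, D) · P(D) ≥ P(s ↔ a, D) · P(s ↔ b, D)`. -/
def R14 (p : E → R) (ends : E → Sym2 V) (s t u a b : V) : Prop :=
  prob p (connEvent ends s a ∩ pairSep ends s t u) *
      prob p (connEvent ends s b ∩ pairSep ends s t u) ≤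
    prob p (connEvent ends s a ∩ connEvent ends s b ∩ pairSep ends s t u) *
      prob p (pairSep ends s t u)

/-- **R11 / SEP-MONO** (uniform weights `q`): if `S ⊆ V ∖ {s, t}` separates `s` from `t`, then
`q ↦ P_q(s ↔ t | s ↔ S) = P_q(s ↔ t, s ↔ S) / P_q(s ↔ S)` is non-decreasing on `(0, 1)`. -/
def R11 (ends : E → Sym2 V) (S : Finset V) (s t : V) : Prop :=
  s ∉ S → t ∉ S → Separates ends S s t →
    ∀ q q' : R, 0 < q → q ≤ q' → q' < 1 →
      prob (fun _ => q) (connEvent ends s t ∩ hitEvent ends s S) /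
          prob (fun _ => q) (hitEvent ends s S) ≤
        prob (fun _ => q') (connEvent ends s t ∩ hitEvent ends s S) /
          prob (fun _ => q') (hitEvent ends s S)

/-- The conditional covariance of `{s ↔ a}` and `{s ↔ b}` given `{s ↮ t}`, cleared of the
denominator: `P(s ↔ a, s ↔ b, s ↮ t) · P(s ↮ t) − P(s ↔ a, s ↮ t) · P(s ↔ b, s ↮ t)`
(vdB–Kahn: `≥ 0`). -/
noncomputable def vdBKahnCov (p : E → R) (ends : E → Sym2 V) (s t a b : V) : R :=
  prob p (connEvent ends s a ∩ connEvent ends s b ∩ (connEvent ends s t)ᶜ) *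
      prob p (connEvent ends s t)ᶜ -
    prob p (connEvent ends s a ∩ (connEvent ends s t)ᶜ) *
      prob p (connEvent ends s b ∩ (connEvent ends s t)ᶜ)

/-- **R12 / vdB–Kahn equality locus** (uniform weights): the conditional covariance vanishes for
every `q ∈ (0, 1)` iff `{s, t}` separates `a` from `b`, or `t` separates `s` from `a`, or `t`
separates `s` from `b`. -/
def R12 (ends : E → Sym2 V) (s t a b : V) : Prop :=
  (∀ q : R, 0 < q → q < 1 → vdBKahnCov (fun _ => q) ends s t a b = 0) ↔
    (Separates ends {s, t} a b ∨ Separates ends {t} s a ∨ Separates ends {t} s b)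

end Rows

section Closures

variable (R : Type) [Field R] [LinearOrder R] [IsStrictOrderedRing R]

/-- R4+ for every finite graph, `v ∉ A`, `b ∉ A`, `b ≠ v`. -/
def R4Plus_all : Prop :=
  ∀ (V E : Type) [Fintype V] [DecidableEq V] [Fintype E] [DecidableEq E]
    (ends : E → Sym2 V) (p : E → R), IsProbVec p →
    ∀ (A : Finset V) (hA : A.Nonempty) (v b : V), v ∉ A → b ∉ A → b ≠ v → R4Plus p ends A hA v b

/-- R4f+ for every finite graph and every monotone cluster property `F ∘ C`. -/
def R4fPlus_all : Prop :=
  ∀ (V E : Type) [Fintype V] [DecidableEq V] [Fintype E] [DecidableEq E]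
    (ends : E → Sym2 V) (p : E → R), IsProbVec p →
    ∀ (A : Finset V) (hA : A.Nonempty) (v : V) (F : Set V → R), Monotone F → v ∉ A →
      R4fPlus p ends A hA v (clusterFun ends F)

/-- R2′ for every finite graph. -/
def R2Prime_all : Prop :=
  ∀ (V E : Type) [Fintype V] [DecidableEq V] [Fintype E] [DecidableEq E]
    (ends : E → Sym2 V) (p : E → R), IsProbVec p →
    ∀ (A : Finset V) (v b : V), R2Prime p ends A v b

/-- R2′ restricted to `|A| = 3` (T2-c). -/
def R2Prime_card_three : Prop :=
  ∀ (V E : Type) [Fintype V] [DecidableEq V] [Fintype E] [DecidableEq E]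
    (ends : E → Sym2 V) (p : E → R), IsProbVec p →
    ∀ (A : Finset V) (v b : V), A.card = 3 → R2Prime p ends A v b

/-- R2′f for every finite graph and every monotone cluster property `F ∘ C`. -/
def R2PrimeF_all : Prop :=
  ∀ (V E : Type) [Fintype V] [DecidableEq V] [Fintype E] [DecidableEq E]
    (ends : E → Sym2 V) (p : E → R), IsProbVec p →
    ∀ (A : Finset V) (v : V) (F : Set V → R), Monotone F → R2PrimeF p ends A v (clusterFun ends F)

/-- R14 for every finite graph. -/
def R14_all : Prop :=
  ∀ (V E : Type) [Fintype V] [DecidableEq V] [Fintype E] [DecidableEq E]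
    (ends : E → Sym2 V) (p : E → R), IsProbVec p → ∀ s t u a b : V, R14 p ends s t u a b

/-- R11 for every finite graph. -/
def R11_all : Prop :=
  ∀ (V E : Type) [Fintype V] [DecidableEq V] [Fintype E] [DecidableEq E]
    (ends : E → Sym2 V) (S : Finset V) (s t : V), R11 (R := R) ends S s t

/-- R12 for every finite graph and distinct `s, t, a, b`. -/
def R12_all : Prop :=
  ∀ (V E : Type) [Fintype V] [DecidableEq V] [Fintype E] [DecidableEq E]
    (ends : E → Sym2 V) (s t a b : V), s ≠ t → a ≠ s → a ≠ t → b ≠ s → b ≠ t → a ≠ b →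
      R12 (R := R) ends s t a b

end Closures

/-! ## Basic relations -/

section Lemmas

variable {V : Type*} {E : Type*} [Fintype V] [DecidableEq V] [Fintype E] [DecidableEq E]
  {R : Type*} [Field R] [LinearOrder R] [IsStrictOrderedRing R]

/-- R4+ implies R4 (GOOD-ALL): `P(v ↔ A, v ↔ b) ≤ P(v ↔ b)`. -/
lemma IsGood_of_R4Plus {p : E → R} (hp : IsProbVec p) {ends : E → Sym2 V} {A : Finset V}
    {hA : A.Nonempty} {v b : V} (h : R4Plus p ends A hA v b) : IsGood p ends A hA v b :=
  le_trans h (prob_inter_le_right hp _ _)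

omit [Fintype V] [DecidableEq V] [IsStrictOrderedRing R] in
/-- R2′ implies `(3)` (`PreFKG`): the minimum is attained at some minimiser. -/
lemma PreFKG_of_R2Prime {p : E → R} {ends : E → Sym2 V} {A : Finset V} (hA : A.Nonempty)
    {v b : V} (h : R2Prime p ends A v b) : PreFKG p ends A hA v b := by
  obtain ⟨a, ha, hmin⟩ := Finset.exists_mem_eq_inf' hA fun a => prob p (connEvent ends a b)
  rw [PreFKG_iff_exists]
  refine ⟨a, ha, h a ha fun a' ha' => ?_⟩
  rw [← hmin]
  exact Finset.inf'_le _ ha'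

end Lemmas

end Summit.Ventures.PercRepro2
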